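/-
Copyright (c) 2026. All rights reserved.
Released under Apache 2.0 license as described in the file LICENSE.
Authors: abc-iut cell, statement-typer seat abc-iut-L4-t3 (wave 1; gen 8).
-/
import Literature.AnabelianGeometry.AbsoluteAnabelian.Ltimes.LogFrobeniusIotaEtaSquare
import Literature.AnabelianGeometry.AbsoluteAnabelian.LogFrobeniusIotaAnMonoChains
import HarnessLib

/-!
# [AbsTopIII] Prop 5.8 (vii) / Cor 5.10 (iv)(c): composites of the `ι^{An⊢⊞}_{w,ε}` along `Γ⃗×_w`, and the `ι^{An⊢⊞}`-square of Def 5.4 (iii)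

S. Mochizuki, *Topics in absolute anabelian geometry III: global reconstruction algorithms*,
J. Math. Sci. Univ. Tokyo 22 (2015) 939–1156 [MochizukiAbsTopIII2015]; locators `p.N` = pages of the author's
manuscript (`paper:url-5493eb38cbb7`), read on the page: Def 5.4 (iii) p. 126 (`Γ⃗×_non = Γ⃗^⋉_non ∩ Γ⃗^⋊_non`: the
COMMUTATIVE square `𝒪^× ↪ k̄^× → (k̄^×)^pf` / `𝒪^× → k~ ↪ (k̄^×)^pf`), (v) p. 127 (`Γ⃗×_arc`: the single shell-arrow), Prop 5.8
(ii) p. 139 ("determined by the diagram of Definition 5.4, (iii)"), (vii) p. 142 l. 11–17 (`ι^{An⊢⊞}_{w,ε}` for each EDGE of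
`Γ⃗×_w`), Cor 5.10 (iv)(c) p. 148 l. 39–51 ("the homotopies on `D_{An⊢}` arising from the `ι^{An⊢⊞}_{v,ε}` … generate a contact
structure `ℋ_{An⊢}`"), §0 p. 26 / Def 3.5 (ii) p. 75 (a family of homotopies is closed under composition of pairs and carries
ONE homotopy per pair).

WHY THIS FILE (first brick of the L4-lead's «F-0139″-CLOSER»; proof-side support over this lineage's add-on `IotaAnMono`,
nothing restated).  A contact structure containing the `ι^{An⊢⊞}`-pairs `([φ_{ν₁}], [φ_{ν₂}])` (`Cor510MonoTelecorePinnedIota`,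
`LogFrobeniusMonoTelecorePinnedIota.lean`) contains, by transitivity of its boundary set, the pair `([φ_{ν₁}], [φ_{ν₃}])` for
every vertex `ν₃` REACHABLE from `ν₁` in `Γ⃗×_v`, with homotopy the COMPOSITE of the `ι^{An⊢⊞}` along the way — and ONE such
homotopy per pair, whichever way is taken.  Hence the data a closer must supply and the law it must satisfy:

* `LogVertex.Reach ν₁ ν₂` — reachability in `Γ⃗×_v` (reflexive–transitive closure of its edges; a decidable table on the
  six nonarchimedean / four archimedean vertices), with `refl`, `trans`, `of_inCore`, `isCross_src/_tgt` (only vertices of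
  `Γ⃗×_v` are reachable from vertices of `Γ⃗×_v`);
* `LogVertex.reachChain b F ιF ν₁ ν₂ h` — the composite of edge data `ιF` along `ν₁ ⤳ ν₂`, for ANY family `F` on the vertices of
  `Γ⃗×_v` and ANY edge data (generic in the Boolean `b`, so that it applies to `b := isArc w` without transport); laws
  `reachChain_refl`, `reachChain_inCore` (an edge gives its own datum), `reachChain_trans` — the last one UNDER
  `LogVertex.SquaresCommuteF` (the two 2-chains `𝒪^× → k̄^× → (k̄^×)^pf`, `𝒪^× → k~ → (k̄^×)^pf` compose equally; vacuous at an
  archimedean place), which is exactly what makes "the composite along `ν₁ ⤳ ν₃`" independent of the way;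
* `IotaAnMono.chain I w h`, `IotaAnMono.SquaresCommute I` — the instances for this lineage's `ι^{An⊢⊞}`-data `I`, with the laws
  `chain_refl`, `chain_ι`, `chain_trans`; `SquaresCommute` is a CONDITION on `I` (Def 5.4 (iii) read for `ι^{An⊢⊞}`; print has
  it: "determined by the diagram of Definition 5.4, (iii)", a commutative diagram), necessary for any closer of
  `Cor510MonoTelecorePinnedIota` by one-homotopy-per-pair (`squaresCommute_of_multiplicative`: any assignment of homotopies to
  the reachable pairs that extends the `ι^{An⊢⊞}` and composes along reachability forces the square);
* ★ `squaresCommute_genuineOpen` — **it HOLDS at the genuine open-augmentation carrier** (abc-iut-w5-d053 / abc-iut-w4-d095's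
  `nonarchGenuineMonoAnPfOpen_iotaAnMono`): both composites send a unit `u ∈ 𝒪^×_k̄` to its class `[u] ∈ k̄^× ⧸ μ` (abc-iut-f-101's
  torsion-quotient containers), on Galois groups both are the identity.

MODEL-LEVEL where an instance is named; refereed pre-IUT material; nothing here bears on [IUTchIII] Cor. 3.12; OUR kernel
check, no side taken; typed ≠ proved elsewhere.

**`⋉`-TWIN (cell row «LTIMES-SUCCESSOR», L4-lead m162; typing finding T3g9-F1).**  This file is the verbatim
re-elaboration of `LogFrobeniusIotaAnMonoChains.lean` over the successor interface `LogFrobeniusSettingLtimes`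
(`Ltimes/LogFrobeniusCompatibility.lean`: `ι⊞_{v,ε}` indexed by the edges of `Γ⃗^⋉_v` at EVERY place, [AbsTopIII] Cor 5.5 (iii)
p. 131), produced by the cell recipe `LTIMES-RECIPE.md`: names carry over inside `namespace LogFrobeniusSettingLtimes`, the
section variable is `Lt`, setting-independent declarations are NOT repeated (the originals are in scope), statements and
proofs are otherwise unchanged.  The original file over the frozen interface stays as it is.
-/

set_option autoImplicit false

universe u

open CategoryTheory

namespace Literature.AnabelianGeometry.AbsoluteAnabelian

/-! (Reachability in `Γ⃗×_v` — `LogVertex.Reach` — and the generic composites `LogVertex.reachChain`, `LogVertex.SquaresCommuteF`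
with their laws are the frozen file's, reused.) -/

/-! ## The instances for the `ι^{An⊢⊞}`-data of a §5 setting -/

namespace LogFrobeniusSettingLtimes

namespace IotaAnMono

variable {Vmod : Type u} {isArc : Vmod → Bool} {Lt : LogFrobeniusSettingLtimes Vmod isArc}
variable {hψ : ∀ (w : Vmod) (j : {ν : LogVertex (isArc w) // ν.IsCross}),
  Lt.ψAnMono w j ⋙ Lt.forgetMono w ⋙ Lt.toEmono w ≅ Lt.κAnMono.inverse}
variable (Ia : Lt.IotaAnMono hψ)

/-- **`ι^{An⊢⊞}` along `ν₁ ⤳ ν₂`**: the composite natural transformation `ψ^{An⊢⊞}_{w,ν₁} ⟶ ψ^{An⊢⊞}_{w,ν₂}` of the `ι^{An⊢⊞}_{w,ε}` along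
the reachability (the homotopy of the pair `([φ_{ν₁}], [φ_{ν₂}])` in any family of homotopies containing the `ι^{An⊢⊞}`-pairs).
[cite: MochizukiAbsTopIII2015, Cor 5.10 (iv)(c) p. 148] -/
def chain (w : Vmod) {ν₁ ν₂ : LogVertex (isArc w)} (h : ν₁.Reach ν₂) :
    Lt.ψAnMono w ⟨ν₁, h.isCross_src⟩ ⟶ Lt.ψAnMono w ⟨ν₂, h.isCross_tgt⟩ :=
  LogVertex.reachChain (isArc w) (fun j => Lt.ψAnMono w j) (fun ε hε => Ia.ι w ε hε) ν₁ ν₂ h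

/-- **The `ι^{An⊢⊞}`-square of Def 5.4 (iii)** (a CONDITION on the data `I`, print's "determined by the [commutative] diagram
of Definition 5.4, (iii)"): at every place, `ι^{An⊢⊞}_{𝒪^×→k~} ≫ ι^{An⊢⊞}_{k~↪(k̄^×)^pf} = ι^{An⊢⊞}_{𝒪^×↪k̄^×} ≫ ι^{An⊢⊞}_{k̄^×→(k̄^×)^pf}`.
[cite: MochizukiAbsTopIII2015, Def 5.4 (iii) p. 126] -/
def SquaresCommute : Prop :=
  ∀ w : Vmod, LogVertex.SquaresCommuteF (isArc w) (fun j => Lt.ψAnMono w j) (fun ε hε => Ia.ι w ε hε)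

/-- on the diagonal `ι^{An⊢⊞}` along `ν ⤳ ν` is the identity. [cite: MochizukiAbsTopIII2015, Prop 5.8 (vii) p. 142] -/
theorem chain_refl (w : Vmod) {ν : LogVertex (isArc w)} (h : ν.Reach ν) : Ia.chain w h = 𝟙 _ :=
  LogVertex.reachChain_refl _ _ h

/-- along an edge it is `ι^{An⊢⊞}_{w,ε}` itself. [cite: MochizukiAbsTopIII2015, Prop 5.8 (vii) p. 142] -/
theorem chain_ι (w : Vmod) {ν₁ ν₂ : LogVertex (isArc w)} (ε : LogEdgeTS (isArc w) ν₁ ν₂) (hε : ε.InCore) :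
    Ia.chain w (LogVertex.Reach.of_inCore hε) = Ia.ι w ε hε :=
  LogVertex.reachChain_inCore _ _ ε hε

/-- **transitivity of the composites under the square** (`ι^{An⊢⊞}` along `ν₁ ⤳ ν₂ ⤳ ν₃` is `ι^{An⊢⊞}` along `ν₁ ⤳ ν₃`).
[cite: MochizukiAbsTopIII2015, Cor 5.10 (iv)(c) p. 148] -/
theorem chain_trans (hsq : Ia.SquaresCommute) (w : Vmod) {ν₁ ν₂ ν₃ : LogVertex (isArc w)} (h₁₂ : ν₁.Reach ν₂)
    (h₂₃ : ν₂.Reach ν₃) (h₁₃ : ν₁.Reach ν₃) : Ia.chain w h₁₂ ≫ Ia.chain w h₂₃ = Ia.chain w h₁₃ :=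
  LogVertex.reachChain_trans _ _ (hsq w) h₁₂ h₂₃ h₁₃

/-- naturality of the composite (it is a natural transformation; recorded componentwise for rewriting).
[cite: MochizukiAbsTopIII2015, Prop 5.8 (vii) p. 142] -/
theorem chain_naturality (w : Vmod) {ν₁ ν₂ : LogVertex (isArc w)} (h : ν₁.Reach ν₂) {X Y : Lt.AnMono} (f : X ⟶ Y) :
    (Lt.ψAnMono w ⟨ν₁, h.isCross_src⟩).map f ≫ (Ia.chain w h).app Y =
      (Ia.chain w h).app X ≫ (Lt.ψAnMono w ⟨ν₂, h.isCross_tgt⟩).map f :=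
  (Ia.chain w h).naturality f

/-- **`ι^{An⊢⊞}` along `ν₁ ⤳ ν₂` lies over the identity of `Th⊢[Z]`** (from `ι_over` edge by edge): its image under
`𝒩⊢⊞_w → 𝒩⊢_w → ℰ⊢` is `hψ_{ν₁} ≫ hψ_{ν₂}⁻¹` at every object. [cite: MochizukiAbsTopIII2015, Prop 5.8 (vii) p. 142] -/
theorem chain_over (w : Vmod) {ν₁ ν₂ : LogVertex (isArc w)} (h : ν₁.Reach ν₂) (X : Lt.AnMono) :
    (Lt.toEmono w).map ((Lt.forgetMono w).map ((Ia.chain w h).app X)) =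
      (hψ w ⟨ν₁, h.isCross_src⟩).hom.app X ≫ (hψ w ⟨ν₂, h.isCross_tgt⟩).inv.app X := by
  refine LogVertex.reachChain_induction (b := isArc w) (fun j => Lt.ψAnMono w j) (fun ε hε => Ia.ι w ε hε)
    (fun j₁ j₂ f => ∀ X : Lt.AnMono,
      (Lt.toEmono w).map ((Lt.forgetMono w).map (f.app X)) = (hψ w j₁).hom.app X ≫ (hψ w j₂).inv.app X)
    (fun j X => ?_) (fun j₁ j₂ j₃ f g hf hg X => ?_) (fun μ₁ μ₂ ε hε X => Ia.ι_over w ε hε X) h X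
  · rw [NatTrans.id_app, CategoryTheory.Functor.map_id, CategoryTheory.Functor.map_id, Iso.hom_inv_id_app]
    rfl
  · rw [NatTrans.comp_app, Functor.map_comp, Functor.map_comp, hf X, hg X]
    erw [Category.assoc, Iso.inv_hom_id_app_assoc]
    rfl

/-- **One homotopy per pair forces the square**: if two 2-chains of `ι^{An⊢⊞}`'s with the same endpoints are both composites
"along `𝒪^× ⤳ (k̄^×)^pf`" of ONE family — formally: if some assignment `θ` of a natural transformation to every reachable pair
extends the `ι^{An⊢⊞}` on edges and is multiplicative along reachability — then `SquaresCommute` holds (the necessity of the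
law for any closer of `Cor510MonoTelecorePinnedIota`). [cite: MochizukiAbsTopIII2015, Def 3.5 (ii) p. 75] -/
theorem squaresCommute_of_multiplicative
    (θ : ∀ (w : Vmod) {ν₁ ν₂ : LogVertex (isArc w)} (h : ν₁.Reach ν₂),
      Lt.ψAnMono w ⟨ν₁, h.isCross_src⟩ ⟶ Lt.ψAnMono w ⟨ν₂, h.isCross_tgt⟩)
    (hθι : ∀ (w : Vmod) {ν₁ ν₂ : LogVertex (isArc w)} (ε : LogEdgeTS (isArc w) ν₁ ν₂) (hε : ε.InCore),
      θ w (LogVertex.Reach.of_inCore hε) = Ia.ι w ε hε)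
    (hθ : ∀ (w : Vmod) {ν₁ ν₂ ν₃ : LogVertex (isArc w)} (h₁₂ : ν₁.Reach ν₂) (h₂₃ : ν₂.Reach ν₃) (h₁₃ : ν₁.Reach ν₃),
      θ w h₁₂ ≫ θ w h₂₃ = θ w h₁₃) :
    Ia.SquaresCommute := by
  intro w
  -- reduce to a statement about a general Boolean kind of place
  suffices key : ∀ (b : Bool) (F : {ν : LogVertex b // ν.IsCross} → (Lt.AnMono ⥤ Lt.NmonoPlus w))
      (ιF : ∀ {μ₁ μ₂ : LogVertex b} (ε : LogEdgeTS b μ₁ μ₂) (hε : ε.InCore), F ⟨μ₁, hε.isCross_src⟩ ⟶ F ⟨μ₂, hε.isCross_tgt⟩)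
      (θ' : ∀ {ν₁ ν₂ : LogVertex b} (h : ν₁.Reach ν₂), F ⟨ν₁, h.isCross_src⟩ ⟶ F ⟨ν₂, h.isCross_tgt⟩),
      (∀ {ν₁ ν₂ : LogVertex b} (ε : LogEdgeTS b ν₁ ν₂) (hε : ε.InCore), θ' (LogVertex.Reach.of_inCore hε) = ιF ε hε) →
      (∀ {ν₁ ν₂ ν₃ : LogVertex b} (h₁₂ : ν₁.Reach ν₂) (h₂₃ : ν₂.Reach ν₃) (h₁₃ : ν₁.Reach ν₃),
        θ' h₁₂ ≫ θ' h₂₃ = θ' h₁₃) →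
      LogVertex.SquaresCommuteF b F ιF from
    key (isArc w) _ _ (fun h => θ w h) (fun ε hε => hθι w ε hε) (fun h₁₂ h₂₃ h₁₃ => hθ w h₁₂ h₂₃ h₁₃)
  intro b F ιF θ' hι hmul
  cases b
  · change ιF NonarchEdge.shell _ ≫ ιF NonarchEdge.shellCodToPerf _ = ιF NonarchEdge.unitsToMult _ ≫ ιF NonarchEdge.multToPerf _
    rw [← hι NonarchEdge.shell NonarchEdge.inCore_shell, ← hι NonarchEdge.shellCodToPerf NonarchEdge.inCore_of_ne.2.2,
      ← hι NonarchEdge.unitsToMult NonarchEdge.inCore_of_ne.1, ← hι NonarchEdge.multToPerf NonarchEdge.inCore_of_ne.2.1]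
    have h₁₃ : LogVertex.Reach (b := false) NonarchVertex.units NonarchVertex.perf := rfl
    exact (hmul _ _ h₁₃).trans (hmul _ _ h₁₃).symm
  · trivial

end IotaAnMono

/-! (Non-vacuity: `SquaresCommute` at the frozen genuine carrier `genuineOpen p V` is the frozen file's
`squaresCommute_genuineOpen`; the genuine archimedean instance over the successor is the cell's row S3.) -/

end LogFrobeniusSettingLtimes

end Literature.AnabelianGeometry.AbsoluteAnabelian
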